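import Mathlib
import Summits.NavierStokesRegularity.NavierStokesRegularity.Theorems.TaoLadderRungTwoBreakBlowupRigidityOneBlowupProfile
import Summits.NavierStokesRegularity.NavierStokesRegularity.Theorems.TaoLadderRungTwoBreakBlowupRigidityOneEternalLawClosure
import HarnessLib

/-!
# TYPE I ⇒ A NON-TRIVIAL UNIFORMLY BOUNDED SOLUTION OF THE INVISCID ETERNAL LAW ON ALL OF ℝ —
  the Koch–Nadirashvili–Seregin–Šverák extraction «type-I blow-up ⇒ non-trivial bounded ancient solution»
  one model down, LAW-ONLY, for the extraction stub `stub_eternalFromBlowup` of K2(1)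
  `TaoLadderRungTwoBreak.BlowupRigidityOne` (stmt-NavierStokesRegularity-20206)

MODEL lattice ODEs only (Tao 2016 §4 (4.8)/(4.12) in the self-similar log-time variables of §6.4); nothing here
is a statement about the Navier–Stokes equations; NO item is closed (`--supports stmt-NavierStokesRegularity-20206`).
Route-independent; general number of modes `m`.

The registered stub asks: robust blow-up (`NoGlobalCascade ε₀ α X₀`, `α ∈ E₂(R)`) ⇒
`∃ W, IsEternal ε₀ α W ∧ EternalSurvivingFwd 1 ε₀ W`. The tree holds the physical-time half
(`blowupProfile_of_noGlobalCascade`: the maximal exact flow, its renormalisation `W̃_n(σ) = Λ^n e^{-σ} x_n(T⋆-e^{-σ})`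
solving the law of `IsEternal` on the half-line `e^{-σ} < T⋆`, NON-DEGENERATE there; `renormalisedFlow_lipschitz_of_typeI`)
and, with this hand, the ν = 0 compactness core (`eternalLaw_of_continuousLimit`). This file composes them:

* `eternalLawLimit_of_typeI` — **ω-LIMITS EXIST AND SOLVE THE LAW.** Under the TYPE-I bound
  `Λ^n (T-t)‖x_n(t)‖ ≤ C` of an exact flow on `[0,T)`, for ANY shell centres `d_j ∈ ℤ` and log-time centres
  `s_j → +∞` a subsequence of the translates `W̃_{n+d_j}(σ + s_j)` converges continuously to a `W : ℤ → ℝ → ℝ^m`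
  solving the law of `IsEternal ε₀ α` at EVERY `σ ∈ ℝ` with `‖W_n(σ)‖ ≤ C` (Arzelà–Ascoli `exists_subseq_continuousLimit`
  of the proved kit ⟨22744⟩ + `eternalLaw_of_continuousLimit`).
* `nontrivialEternalLaw_of_noGlobalCascade_of_typeI` — **KNSS ONE MODEL DOWN (law-only).** For a robust blow-up of a
  table of `E₂(R)`: IF its maximal exact flow is type I (the open a-priori bound, cell N-39), then — centring the
  translates on the shells carrying the non-degeneracy floor `1/(m²(3+Λ))` of `blowupProfile_of_noGlobalCascade` — some
  ω-limit is a NON-TRIVIAL (`‖W_0(0)‖ ≥ 1/(2m²(3+Λ)) > 0`) uniformly bounded (`UniformBound`) solution of the inviscid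
  eternal law on all of `ℝ`.

HONEST LABEL / what remains for the stub after this file: (E3) the type-I bound itself (open; only the LOWER rate
bound is a theorem, `criticalRate_of_noGlobalCascade`); the admissibility clauses `action` (uniform per-shell log-time
action) and `bdd` (per-shell forward envelope) of `IsEternal` and `EternalSurvivingFwd 1` for the limit — these do not
follow from type I alone but need the (E2) data (per-shell action ceiling, energy ceiling and firing floor of the
blow-up at the surviving rate, cf. the `Pinned` class of the viscous kit ⟨22744⟩); and the classification stub
`stub_eternalIsDSS` (open problem). No stub, crux or summit is proved here.
-/

noncomputable section

-- the summit and its single sub-problem share the name (CONVENTIONS §1)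
set_option linter.dupNamespace false

open Set Filter Topology

namespace Summit.NavierStokesRegularity.NavierStokesRegularity.Theorems

namespace BlowupRigidityOne

open Literature.Analysis.FluidPDE Literature.Analysis.FluidPDE.TaoCascade
open Summit.NavierStokesRegularity.NavierStokesRegularity.Cruxes.MinimalBlowupExtraction.Extraction
  (exists_subseq_continuousLimit)

variable {m : ℕ}

/-- **TYPE I ⇒ ω-LIMITS OF THE RENORMALISED FLOW EXIST AND SOLVE THE INVISCID ETERNAL LAW ON ALL OF `ℝ`.**
Let `X` be an exact flow on `[0,T)`, `T > 0` (`C¹` on `[0,T)`, exact one-sided law), `W̃` its renormalisation around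
`T`, and assume the TYPE-I bound `Λ^n (T-t)‖x_n(t)‖ ≤ C`. Then for every choice of shell centres `d_j ∈ ℤ` and
log-time centres `s_j → +∞` there are a subsequence `φ` and `W : ℤ → ℝ → ℝ^m` such that the translates
`W̃_{n+d_{φ j}}(u + s_{φ j})` converge CONTINUOUSLY to `W` (`u_j → σ ⇒ … (u_j) → W_n(σ)`), `W` satisfies the law of
`IsEternal ε₀ α` at EVERY `σ ∈ ℝ`, and `‖W_n(σ)‖ ≤ C`. (The translates solve the law on the receding half-lines
`u > -log T - s_j`, are bounded by `C` (`uniformBound_iff_typeI`) and equi-Lipschitz (`renormalisedFlow_lipschitz_of_typeI`);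
Arzelà–Ascoli `exists_subseq_continuousLimit`; closure `eternalLaw_of_continuousLimit`.)
[cite: Tao2016AveragedNS, §6.4 with §4 (4.8), (4.12); KochNadirashviliSereginSverak2009, Thm 1.1 ff. (rescaling-compactness shape); Teschl2012, §2.6; cell vocabulary (`IsEternal`, `UniformBound`)] -/
theorem eternalLawLimit_of_typeI {ε₀ T C : ℝ} (hε : 0 < ε₀) (hT : 0 < T)
    {α : Fin m → Fin m → Fin m → ℤ × ℤ × ℤ → ℝ}
    {X : Fin m → ℤ → ℝ → ℝ} (hC1 : ∀ i n, ContDiffOn ℝ 1 (X i n) (Set.Ico 0 T))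
    (hmot : ∀ i n t, 0 ≤ t → t < T → derivWithin (X i n) (Set.Ici 0) t = quadTerm ε₀ α X i n t)
    {W : ℤ → ℝ → Em m}
    (hW : ∀ n σ, W n σ = (bigLam ε₀ ^ n * Real.exp (-σ)) • shellVec X n (T - Real.exp (-σ)))
    (htypeI : ∀ (n : ℤ) (t : ℝ), 0 ≤ t → t < T → bigLam ε₀ ^ n * (T - t) * ‖shellVec X n t‖ ≤ C)
    (d : ℕ → ℤ) (s : ℕ → ℝ) (hs : Tendsto s atTop atTop) :
    ∃ φ : ℕ → ℕ, StrictMono φ ∧ ∃ Wlim : ℤ → ℝ → Em m,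
      (∀ (n : ℤ) (u : ℕ → ℝ) (σ : ℝ), Tendsto u atTop (𝓝 σ) →
        Tendsto (fun j => W (n + d (φ j)) (u j + s (φ j))) atTop (𝓝 (Wlim n σ))) ∧
      (∀ (n : ℤ) (σ : ℝ), HasDerivAt (Wlim n) (-((1 : ℝ) • Wlim n σ) + tableQ α (Wlim n σ)
        + bigLam ε₀ • tableA α (Wlim (n - 1) σ) + (bigLam ε₀)⁻¹ • tableB α (Wlim (n + 1) σ) (Wlim n σ)) σ) ∧
      (∀ (n : ℤ) (σ : ℝ), ‖Wlim n σ‖ ≤ C) := by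
  -- the receding thresholds of the translates
  set a : ℕ → ℝ := fun j => -Real.log T - s j with ha_def
  have hwin : ∀ (j : ℕ) (u : ℝ), a j < u → Real.exp (-(u + s j)) < T := by
    intro j u hu
    have hu' : -(u + s j) < Real.log T := by
      have : -Real.log T - s j < u := hu
      linarith
    calc Real.exp (-(u + s j)) < Real.exp (Real.log T) := Real.exp_lt_exp.2 hu'
      _ = T := Real.exp_log hT
  have ha : Tendsto a atTop atBot := by
    refine tendsto_atBot.2 fun b => ?_
    exact (hs.eventually (eventually_ge_atTop (-Real.log T - b))).mono fun j hj => by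
      show -Real.log T - s j ≤ b
      linarith
  -- the translates, their law, bound and Lipschitz constant
  set g : ℕ → ℤ → ℝ → Em m := fun j n u => W (n + d j) (u + s j) with hg_def
  have hlawg : ∀ (j : ℕ) (n : ℤ) (u : ℝ), a j < u → HasDerivAt (g j n)
      (-((1 : ℝ) • g j n u) + tableQ α (g j n u) + bigLam ε₀ • tableA α (g j (n - 1) u)
        + (bigLam ε₀)⁻¹ • tableB α (g j (n + 1) u) (g j n u)) u := by
    intro j n u hu
    have h := (renormalisedFlow_law hε hC1 hmot hW (n + d j) (hwin j u hu)).comp_add_const u (s j)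
    have e1 : n + d j - 1 = n - 1 + d j := by ring
    have e2 : n + d j + 1 = n + 1 + d j := by ring
    rw [e1, e2] at h
    exact h
  have hbdg : ∀ (j : ℕ) (n : ℤ) (u : ℝ), a j < u → ‖g j n u‖ ≤ C := fun j n u hu =>
    (uniformBound_iff_typeI (C := C) hε hW).2 htypeI (n + d j) (u + s j) (hwin j u hu).le
  set K : ℝ := C + (shiftConst α (0, 0, 0) + bigLam ε₀ * shiftConst α (0, 0, 1)) * C ^ 2
    + (bigLam ε₀)⁻¹ * (shiftConst α (1, 0, 0) + shiftConst α (0, 1, 0)) * C ^ 2 with hK_def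
  have hlipg : ∀ (j : ℕ) (n : ℤ) (u v : ℝ), a j < u → u ≤ v → ‖g j n v - g j n u‖ ≤ K * (v - u) := by
    intro j n u v hu huv
    have h := renormalisedFlow_lipschitz_of_typeI hε hC1 hmot hW htypeI (n + d j) (hwin j u hu)
      (show u + s j ≤ v + s j by linarith)
    have e : v + s j - (u + s j) = v - u := by ring
    rw [e] at h
    exact h
  -- Arzelà–Ascoli on the receding half-lines
  have hJ : ∀ a' : ℝ, ∃ J : ℕ, ∀ j, J ≤ j → a j < a' := fun a' =>
    eventually_atTop.1 (ha.eventually (eventually_lt_atBot a'))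
  have hB : ∀ (n : ℤ) (a' : ℝ), ∃ C' : ℝ, ∃ J : ℕ, ∀ j, J ≤ j → ∀ u : ℝ, a' ≤ u → ‖g j n u‖ ≤ C' := by
    intro n a'
    obtain ⟨J, hJ'⟩ := hJ a'
    exact ⟨C, J, fun j hj u hu => hbdg j n u (lt_of_lt_of_le (hJ' j hj) hu)⟩
  have hL : ∀ (n : ℤ) (a' : ℝ), ∃ K' : ℝ, ∃ J : ℕ, ∀ j, J ≤ j → ∀ u v : ℝ, a' ≤ u → a' ≤ v →
      ‖g j n u - g j n v‖ ≤ K' * |u - v| := by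
    intro n a'
    obtain ⟨J, hJ'⟩ := hJ a'
    refine ⟨K, J, fun j hj u v hu hv => ?_⟩
    rcases le_total u v with huv | hvu
    · rw [norm_sub_rev, abs_sub_comm, abs_of_nonneg (by linarith)]
      exact hlipg j n u v (lt_of_lt_of_le (hJ' j hj) hu) huv
    · rw [abs_of_nonneg (by linarith)]
      exact hlipg j n v u (lt_of_lt_of_le (hJ' j hj) hv) hvu
  obtain ⟨φ, hφ, Wlim, hconv⟩ := exists_subseq_continuousLimit g hB hL
  -- the limit solves the law and inherits the bound
  have ha' : Tendsto (fun j => a (φ j)) atTop atBot := ha.comp hφ.tendsto_atTop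
  have hlaw' : ∀ (j : ℕ) (n : ℤ) (u : ℝ), a (φ j) < u → HasDerivAt (g (φ j) n)
      (-((1 : ℝ) • g (φ j) n u) + tableQ α (g (φ j) n u) + bigLam ε₀ • tableA α (g (φ j) (n - 1) u)
        + (bigLam ε₀)⁻¹ • tableB α (g (φ j) (n + 1) u) (g (φ j) n u)) u := fun j n u hu =>
    hlawg (φ j) n u hu
  have hbd' : ∀ (j : ℕ) (n : ℤ) (u : ℝ), a (φ j) < u → ‖g (φ j) n u‖ ≤ C := fun j n u hu =>
    hbdg (φ j) n u hu
  refine ⟨φ, hφ, Wlim, fun n u σ hu => hconv n u σ hu, fun n σ => ?_, fun n σ => ?_⟩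
  · exact eternalLaw_of_continuousLimit (V := fun j => g (φ j)) hlaw' hbd' ha' hconv n σ
  · exact norm_limit_le_of_receding (V := fun j => g (φ j)) hbd' ha' hconv n σ

/-- **KNSS ONE MODEL DOWN, LAW-ONLY: TYPE-I ROBUST BLOW-UP HAS A NON-TRIVIAL UNIFORMLY BOUNDED ETERNAL
ω-LIMIT SOLVING THE INVISCID LAW ON ALL OF `ℝ`.** Let `NoGlobalCascade ε₀ α X₀` with `ε₀ > 0`, `α ∈ E₂(R)`.
There are the blow-up time `T > 0` and the maximal exact flow `X` from the one-shell datum (`C¹` on `[0,T)`,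
datum, no shells below `0`, exact motion, critical amplitude unbounded on shells `k → ∞`) such that for EVERY
renormalisation `W̃_n(σ) = (Λ^n e^{-σ}) • x_n(T - e^{-σ})` and every constant `C`: IF the flow is TYPE I with
constant `C` (`Λ^n (T-t)‖x_n(t)‖ ≤ C`, the open a-priori bound N-39), THEN there are shell / log-time centres
`d_j`, `s_j → +∞` and `W : ℤ → ℝ → ℝ^m` with `W̃_{n+d_j}(σ + s_j) → W_n(σ)` such that `W` solves the law of
`IsEternal ε₀ α` at every `σ ∈ ℝ`, `UniformBound W` (indeed `‖W_n(σ)‖ ≤ C`), and `W` is NON-TRIVIAL: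
`‖W_0(0)‖ ≥ 1/(2m²(3+Λ)) > 0` (the centres are chosen on the shells carrying the non-degeneracy floor of
`blowupProfile_of_noGlobalCascade`). What this is NOT: `W` is not shown admissible (`action`, `bdd`) nor
forward-surviving — the remaining content of `stub_eternalFromBlowup` beyond type I.
[cite: Tao2016AveragedNS, §4 Thm. 4.2, (4.12), §6.4; KochNadirashviliSereginSverak2009, Thm 1.1 ff. («type I ⇒ bounded ancient solution» by rescaling-compactness); Teschl2012, §2.6; cell vocabulary (`IsEternal`, `UniformBound`, `NoGlobalCascade`)] -/
theorem nontrivialEternalLaw_of_noGlobalCascade_of_typeI {ε₀ R : ℝ} (hε : 0 < ε₀)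
    {α : Fin m → Fin m → Fin m → ℤ × ℤ × ℤ → ℝ} {X₀ : Fin m → ℝ} (hα : InTableClass R α)
    (hNG : NoGlobalCascade ε₀ α X₀) :
    ∃ (T : ℝ) (X : Fin m → ℤ → ℝ → ℝ), 0 < T ∧
      (∀ i n, ContDiffOn ℝ 1 (X i n) (Set.Ico 0 T)) ∧
      (∀ i n, X i n 0 = if n = 0 then X₀ i else 0) ∧
      (∀ i n t, n < 0 → X i n t = 0) ∧
      (∀ i n t, 0 ≤ t → t < T → derivWithin (X i n) (Set.Ici 0) t = quadTerm ε₀ α X i n t) ∧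
      (∀ (K : ℤ) (L : ℝ), ∃ t : ℝ, 0 ≤ t ∧ t < T ∧
        ∃ (i : Fin m) (k : ℤ), K < k ∧ L < (1 + ε₀) ^ ((5 : ℝ) * k / 2) * |X i k t|) ∧
      ∀ W : ℤ → ℝ → Em m,
        (∀ n σ, W n σ = (bigLam ε₀ ^ n * Real.exp (-σ)) • shellVec X n (T - Real.exp (-σ))) →
        ∀ C : ℝ, (∀ (n : ℤ) (t : ℝ), 0 ≤ t → t < T → bigLam ε₀ ^ n * (T - t) * ‖shellVec X n t‖ ≤ C) →
          ∃ (d : ℕ → ℤ) (s : ℕ → ℝ) (Wlim : ℤ → ℝ → Em m), Tendsto s atTop atTop ∧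
            (∀ (n : ℤ) (σ : ℝ), Tendsto (fun j => W (n + d j) (σ + s j)) atTop (𝓝 (Wlim n σ))) ∧
            (∀ (n : ℤ) (σ : ℝ), HasDerivAt (Wlim n) (-((1 : ℝ) • Wlim n σ) + tableQ α (Wlim n σ)
              + bigLam ε₀ • tableA α (Wlim (n - 1) σ)
              + (bigLam ε₀)⁻¹ • tableB α (Wlim (n + 1) σ) (Wlim n σ)) σ) ∧
            UniformBound Wlim ∧ (∀ (n : ℤ) (σ : ℝ), ‖Wlim n σ‖ ≤ C) ∧
            0 < 1 / (2 * ((m : ℝ) ^ 2 * (3 + bigLam ε₀))) ∧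
            1 / (2 * ((m : ℝ) ^ 2 * (3 + bigLam ε₀))) ≤ ‖Wlim 0 0‖ := by
  obtain ⟨T, X, hT, h1, h2, h3, h4, -, -, hhigh, hprof⟩ := blowupProfile_of_noGlobalCascade hε hα hNG
  refine ⟨T, X, hT, h1, h2, h3, h4, hhigh, fun W hW C htypeI => ?_⟩
  obtain ⟨-, hnondeg⟩ := hprof W hW
  -- `m ≥ 1` (a blow-up has a mode), so the non-degeneracy floor is positive
  have hm : 0 < m := by
    rcases Nat.eq_zero_or_pos m with h0 | hpos
    · subst h0
      obtain ⟨-, -, -, i, -⟩ := hhigh 0 0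
      exact i.elim0
    · exact hpos
  have hL : 0 < bigLam ε₀ := bigLam_pos (by linarith)
  have hD : 0 < (m : ℝ) ^ 2 * (3 + bigLam ε₀) := by
    have : (0 : ℝ) < m := by exact_mod_cast hm
    positivity
  set L₀ : ℝ := 1 / (2 * ((m : ℝ) ^ 2 * (3 + bigLam ε₀))) with hL₀_def
  have hL₀pos : 0 < L₀ := by positivity
  have hL₀ : L₀ * ((m : ℝ) ^ 2 * (3 + bigLam ε₀)) < 1 := by
    rw [hL₀_def, div_mul_eq_mul_div, one_mul, div_lt_one (by positivity)]
    linarith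
  -- log-time centres `s_j = j + 1 - log T → ∞` inside the half-line, shell centres on the floor
  set s : ℕ → ℝ := fun j => (j : ℝ) + (1 - Real.log T) with hs_def
  have hs : Tendsto s atTop atTop := tendsto_atTop_add_const_right _ _ tendsto_natCast_atTop_atTop
  have hsj : ∀ j : ℕ, Real.exp (-(s j)) < T := by
    intro j
    have hj : -(s j) < Real.log T := by
      show -((j : ℝ) + (1 - Real.log T)) < Real.log T
      have : (0 : ℝ) ≤ j := Nat.cast_nonneg j
      linarith
    calc Real.exp (-(s j)) < Real.exp (Real.log T) := Real.exp_lt_exp.2 hj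
      _ = T := Real.exp_log hT
  choose d hd using fun j : ℕ => hnondeg (s j) (hsj j) L₀ hL₀
  obtain ⟨φ, hφ, Wlim, hconv, hlaw, hbdd⟩ := eternalLawLimit_of_typeI hε hT h1 h4 hW htypeI d s hs
  have hfloor : L₀ ≤ ‖Wlim 0 0‖ := by
    have hc := (hconv 0 (fun _ => (0 : ℝ)) 0 tendsto_const_nhds).norm
    refine ge_of_tendsto hc (Eventually.of_forall fun j => ?_)
    have := (hd (φ j)).le
    simpa only [zero_add] using this
  refine ⟨fun j => d (φ j), fun j => s (φ j), Wlim, hs.comp hφ.tendsto_atTop, fun n σ => ?_, hlaw,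
    ⟨C, hbdd⟩, hbdd, hL₀pos, hfloor⟩
  exact hconv n (fun _ => σ) σ tendsto_const_nhds

end BlowupRigidityOne

end Summit.NavierStokesRegularity.NavierStokesRegularity.Theorems

end
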